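import Literature.NumberTheory.EllipticCurves.ModularSymbolsManinGeneration
import Mathlib.Algebra.MvPolynomial.Funext
import HarnessLib

/-!
# `p`-stabilisation of `T_p`-eigensymbols

For a level `N` prime to `p` the Hecke operator `T_p = Σ_{j mod p} (·)|βⱼ + (·)|δ`, `δ = diag(p, 1)`
(`CoeffActionOn.hecke N p` with the index set `ℤ/p ∪ {∞}` of `HeckeOperatorsGamma0Proofs`), while
at level `Np` only `U_p = Σ_j (·)|βⱼ` survives.  For a `T_p`-eigensymbol `φ ∈ Symb_{Γ₀(N)}(V)`,
`T_p φ = a_p φ`, the two symbols `φ` and `ψ = φ|δ` are `Γ₀(Np)`-invariant (`slash_delta_mem_Symb`,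
`δ Γ₀(Np) δ⁻¹ ⊆ Γ₀(N)`), `U_p φ = a_p φ − ψ` (`hecke_level_mul`) and `U_p ψ = W φ` as soon as the
coefficients are homogeneous of some degree in the scalar matrices — `W = p^{n+1}` for `Symⁿ`
(`hecke_slash_delta_symPow`); hence for a unit root `α` of `X² − a_p X + W` the **`p`-stabilised
symbol `φ_α = φ − α⁻¹ ψ ∈ Symb_{Γ₀(Np)}(V)` is a `U_p`-eigensymbol with eigenvalue `α`**
(`hecke_pStabilise`, `pStabilise_mem_Symb`; Mazur–Tate–Teitelbaum 1986, §I.10 (the measure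
`μ_{f,α}`); Greenberg–Stevens 1993, (4.8)–(4.9)).  This is the algebraic form of the
`p`-stabilisation `f_α(z) = f(z) − (p^{k-1}/α) f(pz)` of an eigenform of weight `k = n + 2`,
`α² − a_p α + p^{k−1} = 0`.

Everything is proved; no named facts.

## References

* B. Mazur, J. Tate, J. Teitelbaum, Invent. Math. 84 (1986), §I.10. [MazurTateTeitelbaum1986Invent]
* R. Greenberg, G. Stevens, Invent. Math. 111 (1993), §4, (4.8)–(4.9). [GreenbergStevens1993]
* G. Shimura, *Introduction to the arithmetic theory of automorphic functions* (1971), §3.4. [Shimura1971]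
-/

noncomputable section

open scoped MatrixGroups
open Matrix CongruenceSubgroup

namespace Literature.NumberTheory.EllipticCurves

open ModularForms ModularForms.HidaCohomology

/-! ### Scalar matrices act trivially on `ℙ¹(ℚ)` -/

/-- **`(c M)·x = M·x` on `ℙ¹(ℚ)`** for `c ≠ 0`. [folklore] -/
theorem P1Q.act_smul {c : ℤ} (hc : c ≠ 0) {g : Matrix (Fin 2) (Fin 2) ℤ} (hg : g.det ≠ 0) (x : P1Q) :
    P1Q.act (c • g) x = P1Q.act g x := by
  have hcg : (c • g).det ≠ 0 := by
    rw [Matrix.det_smul, Fintype.card_fin]; exact mul_ne_zero (pow_ne_zero _ hc) hg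
  obtain ⟨v, hv, rfl⟩ : ∃ (v : Fin 2 → ℚ) (hv : v ≠ 0), x = Projectivization.mk ℚ v hv :=
    ⟨x.rep, x.rep_nonzero, (Projectivization.mk_rep x).symm⟩
  rw [P1Q.act_mk hcg, P1Q.act_mk hg]
  refine (Projectivization.mk_eq_mk_iff' ℚ _ _ _ _).mpr ⟨(c : ℚ), ?_⟩
  have hmat : P1Q.ratMat (c • g) = (c : ℚ) • P1Q.ratMat g := by
    ext i j
    change (((c • g) i j : ℤ) : ℚ) = (c : ℚ) • ((g i j : ℤ) : ℚ)
    rw [Matrix.smul_apply, smul_eq_mul, smul_eq_mul, Int.cast_mul]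
  rw [hmat, Matrix.smul_mulVec]

/-! ### Levels -/

/-- `Γ₀(Np) ≤ Γ₀(N)` (cf. `ModularForms.gamma0_le_gamma0_of_dvd` of `ModularCurveGenusTwoProofs`, not
imported here to keep this file algebraic). [folklore] -/
theorem mem_gamma0_of_mem_gamma0_mul {N p : ℕ} {γ : SL(2, ℤ)} (hγ : γ ∈ Gamma0 (N * p)) : γ ∈ Gamma0 N := by
  rw [Gamma0_mem] at hγ ⊢
  rw [ZMod.intCast_zmod_eq_zero_iff_dvd] at hγ ⊢
  exact (Int.natCast_dvd_natCast.mpr (dvd_mul_right N p)).trans hγ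

namespace CoeffActionOn

variable {S : Set (Matrix (Fin 2) (Fin 2) ℤ)} {R V : Type*} [CommRing R] [AddCommGroup V] [Module R V]
  (A : CoeffActionOn S R V)

/-- `Symb` is antitone in the group. [folklore] -/
theorem Symb_mono {Γ Γ' : Subgroup SL(2, ℤ)} (h : Γ' ≤ Γ) : A.Symb Γ ≤ A.Symb Γ' :=
  fun _ hφ => ⟨hφ.1, fun γ hγ => hφ.2 γ (h hγ)⟩

end CoeffActionOn

/-! ### The matrix `δ = diag(p, 1)` and its conjugation action `Γ₀(Np) → Γ₀(N)` -/

section Delta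

variable (p : ℕ)

/-- `δ = diag(p, 1)` (`= heckeRep p none`). [cite: Shimura1971, §3.4] -/
def deltaMat : Matrix (Fin 2) (Fin 2) ℤ := !![(p : ℤ), 0; 0, 1]

/-- `heckeRep p none = δ`. [folklore] -/
theorem heckeRep_none_eq_deltaMat : heckeRep p none = deltaMat p := rfl

/-- Entry `(0,0)` of `δ`. [folklore] -/
@[simp] theorem deltaMat_apply00 : deltaMat p 0 0 = p := rfl

/-- Entry `(0,1)` of `δ`. [folklore] -/
@[simp] theorem deltaMat_apply01 : deltaMat p 0 1 = 0 := rfl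

/-- Entry `(1,0)` of `δ`. [folklore] -/
@[simp] theorem deltaMat_apply10 : deltaMat p 1 0 = 0 := rfl

/-- Entry `(1,1)` of `δ`. [folklore] -/
@[simp] theorem deltaMat_apply11 : deltaMat p 1 1 = 1 := rfl

/-- `det δ = p`. [folklore] -/
theorem det_deltaMat : (deltaMat p).det = p := by
  rw [deltaMat, Matrix.det_fin_two_of]; ring

variable {p}

/-- **`δ γ δ⁻¹ = (a, pb; c/p, d) ∈ SL(2, ℤ)`** for `γ = (a b; c d)` with `p ∣ c`. [cite: Shimura1971, §3.4] -/
def deltaConj (γ : SL(2, ℤ)) (h : (p : ℤ) ∣ γ 1 0) : SL(2, ℤ) :=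
  ⟨!![γ 0 0, (p : ℤ) * γ 0 1; γ 1 0 / p, γ 1 1], by
    rw [Matrix.det_fin_two_of]
    have hdet := Matrix.det_fin_two (γ : Matrix (Fin 2) (Fin 2) ℤ)
    rw [Matrix.SpecialLinearGroup.det_coe] at hdet
    have hc : γ 1 0 / (p : ℤ) * (p : ℤ) = γ 1 0 := Int.ediv_mul_cancel h
    linear_combination -hdet - (γ 0 1) * hc⟩

/-- Entries of `deltaConj`. [folklore] -/
theorem coe_deltaConj (γ : SL(2, ℤ)) (h : (p : ℤ) ∣ γ 1 0) :
    (deltaConj γ h : Matrix (Fin 2) (Fin 2) ℤ) = !![γ 0 0, (p : ℤ) * γ 0 1; γ 1 0 / p, γ 1 1] := rfl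

/-- **`δ γ = (δ γ δ⁻¹) δ`.** [cite: Shimura1971, §3.4] -/
theorem deltaMat_mul_eq (γ : SL(2, ℤ)) (h : (p : ℤ) ∣ γ 1 0) :
    deltaMat p * (γ : Matrix (Fin 2) (Fin 2) ℤ) = (deltaConj γ h : Matrix (Fin 2) (Fin 2) ℤ) * deltaMat p := by
  have hc : γ 1 0 / (p : ℤ) * (p : ℤ) = γ 1 0 := Int.ediv_mul_cancel h
  rw [coe_deltaConj, deltaMat]
  ext i j
  fin_cases i <;> fin_cases j <;> simp [Matrix.mul_apply, Fin.sum_univ_two, hc, mul_comm]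

/-- For `γ ∈ Γ₀(Np)`, `p ∣ c`. [folklore] -/
theorem dvd_entry_of_mem_gamma0_mul {N : ℕ} {γ : SL(2, ℤ)} (hγ : γ ∈ Gamma0 (N * p)) : (p : ℤ) ∣ γ 1 0 := by
  rw [Gamma0_mem, ZMod.intCast_zmod_eq_zero_iff_dvd] at hγ
  have h : (p : ℤ) ∣ ((N * p : ℕ) : ℤ) := ⟨N, by push_cast; ring⟩
  exact h.trans hγ

/-- For `γ ∈ Γ₀(Np)`, `δ γ δ⁻¹ ∈ Γ₀(N)`. [cite: Shimura1971, §3.4] -/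
theorem deltaConj_mem_gamma0 {N : ℕ} (hp : p ≠ 0) {γ : SL(2, ℤ)} (hγ : γ ∈ Gamma0 (N * p)) :
    deltaConj γ (dvd_entry_of_mem_gamma0_mul hγ) ∈ Gamma0 N := by
  rw [Gamma0_mem, ZMod.intCast_zmod_eq_zero_iff_dvd] at hγ ⊢
  change (N : ℤ) ∣ γ 1 0 / p
  obtain ⟨m, hm⟩ := hγ
  rw [hm, show ((N * p : ℕ) : ℤ) * m = (N : ℤ) * m * p by push_cast; ring,
    Int.mul_ediv_cancel _ (by exact_mod_cast hp)]
  exact Dvd.intro m rfl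

end Delta

/-! ### `φ|δ` and `U_p` at level `Np` -/

namespace CoeffActionOn

variable {S : Set (Matrix (Fin 2) (Fin 2) ℤ)} {R V : Type*} [CommRing R] [AddCommGroup V] [Module R V]
  (A : CoeffActionOn S R V) {N p : ℕ}

/-- **`φ|δ ∈ Symb_{Γ₀(Np)}`** for `φ ∈ Symb_{Γ₀(N)}` (`δ Γ₀(Np) δ⁻¹ ⊆ Γ₀(N)`). [cite: Shimura1971, §3.4] -/
theorem slash_delta_mem_Symb (hp : p ≠ 0) (hδ : deltaMat p ∈ S) (hΓ : ∀ γ : SL(2, ℤ), γ ∈ Gamma0 N → (γ : Matrix (Fin 2) (Fin 2) ℤ) ∈ S)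
    {φ : P1Q → P1Q → V} (hφ : φ ∈ A.Symb (Gamma0 N)) : A.slash (deltaMat p) φ ∈ A.Symb (Gamma0 (N * p)) := by
  refine ⟨A.slash_mem_modSym _ hφ.1, fun γ hγ => ?_⟩
  have hγN : γ ∈ Gamma0 N := mem_gamma0_of_mem_gamma0_mul hγ
  have hdetδ : (deltaMat p).det ≠ 0 := by rw [det_deltaMat]; exact_mod_cast hp
  have hdetγ : (γ : Matrix (Fin 2) (Fin 2) ℤ).det ≠ 0 := by rw [Matrix.SpecialLinearGroup.det_coe]; exact one_ne_zero
  set γ' := deltaConj γ (dvd_entry_of_mem_gamma0_mul hγ) with hγ'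
  have hγ'N : γ' ∈ Gamma0 N := deltaConj_mem_gamma0 hp hγ
  have hdetγ' : (γ' : Matrix (Fin 2) (Fin 2) ℤ).det ≠ 0 := by rw [Matrix.SpecialLinearGroup.det_coe]; exact one_ne_zero
  rw [← LinearMap.comp_apply, ← A.slash_mul hδ (hΓ γ hγN) hdetδ hdetγ, deltaMat_mul_eq γ (dvd_entry_of_mem_gamma0_mul hγ),
    A.slash_mul (hΓ γ' hγ'N) hδ hdetγ' hdetδ, LinearMap.comp_apply, hφ.2 γ' hγ'N]

/-- At level `Np`, `U_p = Σ_{j mod p} (·)|βⱼ`. [folklore] -/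
theorem hecke_level_mul_eq_sum [NeZero p] (Φ : P1Q → P1Q → V) :
    A.hecke (N * p) p Φ = ∑ j : ZMod p, A.slash (heckeRep p (some j)) Φ := by
  rw [A.hecke_apply, sum_heckeIdx (N * p) p (fun i => A.slash (heckeRep p i) Φ), if_pos (dvd_mul_left p N), add_zero]

/-- **`T_p = U_p + (·)|δ` at level `N` prime to `p`.** [cite: Shimura1971, §3.4] -/
theorem hecke_eq_hecke_level_mul_add [NeZero p] (hpN : ¬ p ∣ N) (Φ : P1Q → P1Q → V) :
    A.hecke N p Φ = A.hecke (N * p) p Φ + A.slash (deltaMat p) Φ := by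
  rw [A.hecke_apply, sum_heckeIdx N p (fun i => A.slash (heckeRep p i) Φ), if_neg hpN, hecke_level_mul_eq_sum,
    heckeRep_none_eq_deltaMat]

/-- The translation matrices `(1 b; 0 1)`. [folklore] -/
def tMat (b : ℤ) : Matrix (Fin 2) (Fin 2) ℤ := !![1, b; 0, 1]

/-- `tMat b = T^b ∈ SL(2, ℤ)`. [folklore] -/
theorem coe_T_zpow_eq_tMat (b : ℤ) : ((ModularGroup.T ^ b : SL(2, ℤ)) : Matrix (Fin 2) (Fin 2) ℤ) = tMat b := by
  rw [ModularGroup.coe_T_zpow, tMat]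

/-- `T^b ∈ Γ₀(N)`. [folklore] -/
theorem T_zpow_mem_gamma0 (N : ℕ) (b : ℤ) : (ModularGroup.T ^ b : SL(2, ℤ)) ∈ Gamma0 N := by
  rw [Gamma0_mem]
  simp [ModularGroup.coe_T_zpow]

/-- **`δ βⱼ = p · (1 j; 0 1)`.** [folklore] -/
theorem deltaMat_mul_heckeRep_some (j : ZMod p) : deltaMat p * heckeRep p (some j) = (p : ℤ) • tMat (j.val : ℤ) := by
  rw [deltaMat, heckeRep, tMat]
  ext i l
  fin_cases i <;> fin_cases l <;> simp [Matrix.mul_apply, Fin.sum_univ_two]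

/-- **`U_p (φ|δ) = Σ_j φ|(δ βⱼ) = Σ_j φ|(p · T^j)`.** [cite: Shimura1971, §3.4] -/
theorem hecke_slash_delta_eq_sum [NeZero p] (hp : p ≠ 0) (hδ : deltaMat p ∈ S) (hβ : ∀ j : ZMod p, heckeRep p (some j) ∈ S)
    (φ : P1Q → P1Q → V) :
    A.hecke (N * p) p (A.slash (deltaMat p) φ) = ∑ j : ZMod p, A.slash ((p : ℤ) • tMat (j.val : ℤ)) φ := by
  rw [hecke_level_mul_eq_sum]
  refine Finset.sum_congr rfl fun j _ => ?_
  have hdetδ : (deltaMat p).det ≠ 0 := by rw [det_deltaMat]; exact_mod_cast hp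
  have hdetβ : (heckeRep p (some j)).det ≠ 0 := by rw [det_heckeRep]; exact_mod_cast hp
  rw [← LinearMap.comp_apply, ← A.slash_mul hδ (hβ j) hdetδ hdetβ, deltaMat_mul_heckeRep_some]

/-! ### The stabilised symbol -/

/-- **`p`-stabilisation of a `T_p`-eigensymbol**: if `T_p φ = a_p φ`, `U_p(φ|δ) = W φ` and
`α² − a_p α + W = 0` for a unit `α`, then `φ_α = φ − α⁻¹ φ|δ` satisfies `U_p φ_α = α φ_α`.
[cite: MazurTateTeitelbaum1986Invent, §I.10] -/
theorem hecke_pStabilise [NeZero p] (hpN : ¬ p ∣ N) {φ : P1Q → P1Q → V} {ap W : R} (hT : A.hecke N p φ = ap • φ)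
    (hψ : A.hecke (N * p) p (A.slash (deltaMat p) φ) = W • φ) (α : Rˣ) (hα : (α : R) ^ 2 - ap * α + W = 0) :
    A.hecke (N * p) p (φ - ((α⁻¹ : Rˣ) : R) • A.slash (deltaMat p) φ) =
      (α : R) • (φ - ((α⁻¹ : Rˣ) : R) • A.slash (deltaMat p) φ) := by
  have hU : A.hecke (N * p) p φ = ap • φ - A.slash (deltaMat p) φ := by
    rw [eq_sub_iff_add_eq, ← A.hecke_eq_hecke_level_mul_add hpN, hT]
  have hkey : ap - ((α⁻¹ : Rˣ) : R) * W = α := by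
    have hW : W = ap * α - (α : R) ^ 2 := by linear_combination hα
    rw [hW]
    linear_combination ((α : R) - ap) * Units.inv_mul α
  rw [map_sub, map_smul, hU, hψ, smul_sub, smul_smul (α : R) (((α⁻¹ : Rˣ) : R)), Units.mul_inv, one_smul, smul_smul, ← hkey,
    sub_smul]
  abel

/-- **The stabilised symbol is `Γ₀(Np)`-invariant.** [folklore] -/
theorem pStabilise_mem_Symb (hp : p ≠ 0) (hδ : deltaMat p ∈ S)
    (hΓ : ∀ γ : SL(2, ℤ), γ ∈ Gamma0 N → (γ : Matrix (Fin 2) (Fin 2) ℤ) ∈ S) {φ : P1Q → P1Q → V}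
    (hφ : φ ∈ A.Symb (Gamma0 N)) (c : R) : φ - c • A.slash (deltaMat p) φ ∈ A.Symb (Gamma0 (N * p)) :=
  sub_mem (A.Symb_mono (fun _ hγ => mem_gamma0_of_mem_gamma0_mul hγ) hφ)
    (Submodule.smul_mem _ c (A.slash_delta_mem_Symb hp hδ hΓ hφ))

end CoeffActionOn

/-! ### Homogeneity of `Symⁿ` and `U_p(φ|δ) = p^{n+1} φ` -/

section SymPow

variable {R : Type*} [CommRing R] [IsDomain R] [Infinite R] {n : ℕ}

/-- A binary form over an infinite integral domain is determined by its values. [folklore] -/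
theorem eq_of_forall_evalVec_eq {x y : Fin (n + 1) → R} (h : ∀ w : Fin 2 → R, evalVec n x w = evalVec n y w) : x = y := by
  apply toPoly_injective
  apply MvPolynomial.funext
  intro w
  rw [← evalVec_eq_eval, ← evalVec_eq_eval, h w]

/-- **`Symⁿ` is homogeneous of degree `n` in the scalar matrices**: `(cM)·a = cⁿ (M·a)`. [folklore] -/
theorem act_smul_matrix (c : ℤ) (M : Matrix (Fin 2) (Fin 2) ℤ) (a : Fin (n + 1) → R) :
    act n (c • M) a = (c : R) ^ n • act n M a := by
  refine eq_of_forall_evalVec_eq fun w => ?_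
  have hmap : (c • M).map (Int.castRingHom R) = (c : R) • M.map (Int.castRingHom R) := by
    ext i j
    rw [Matrix.map_apply, Matrix.smul_apply, Matrix.smul_apply, Matrix.map_apply, smul_eq_mul, smul_eq_mul, map_mul, eq_intCast,
      eq_intCast]
  rw [evalVec_act, evalVec_smul, evalVec_act, hmap, Matrix.smul_mulVec]
  -- homogeneity of the form in its argument
  simp only [evalVec, Pi.smul_apply, smul_eq_mul, Finset.mul_sum]
  refine Finset.sum_congr rfl fun i _ => ?_
  have hi : (i : ℕ) ≤ n := Nat.lt_succ_iff.mp i.isLt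
  have hc : (c : R) ^ n = (c : R) ^ (n - i) * (c : R) ^ (i : ℕ) := by rw [← pow_add, Nat.sub_add_cancel hi]
  rw [hc, mul_pow, mul_pow]
  ring

variable {S : Set (Matrix (Fin 2) (Fin 2) ℤ)}

/-- **`φ|(cM) = cⁿ φ|M` for `Symⁿ`-valued functions** (`c ≠ 0`, `det M ≠ 0`). [folklore] -/
theorem symPowOn_slash_smul {c : ℤ} (hc : c ≠ 0) {M : Matrix (Fin 2) (Fin 2) ℤ} (hM : M.det ≠ 0)
    (φ : P1Q → P1Q → (Fin (n + 1) → R)) :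
    (CoeffActionOn.symPowOn S n R).slash (c • M) φ = (c : R) ^ n • (CoeffActionOn.symPowOn S n R).slash M φ := by
  funext x y
  rw [CoeffActionOn.slash_apply, Pi.smul_apply, Pi.smul_apply, CoeffActionOn.slash_apply, P1Q.act_smul hc hM, P1Q.act_smul hc hM]
  exact act_smul_matrix c M _

variable {N p : ℕ}

/-- **`U_p(φ|δ) = p^{n+1} φ`** for `φ ∈ Symb_{Γ₀(N)}(Symⁿ)`. [cite: MazurTateTeitelbaum1986Invent, §I.10] -/
theorem hecke_slash_delta_symPow [NeZero p] (hp : p ≠ 0) (hδ : deltaMat p ∈ S) (hβ : ∀ j : ZMod p, heckeRep p (some j) ∈ S)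
    {φ : P1Q → P1Q → (Fin (n + 1) → R)} (hφ : φ ∈ (CoeffActionOn.symPowOn S n R).Symb (Gamma0 N)) :
    (CoeffActionOn.symPowOn S n R).hecke (N * p) p ((CoeffActionOn.symPowOn S n R).slash (deltaMat p) φ) = ((p : R) ^ (n + 1)) • φ := by
  rw [(CoeffActionOn.symPowOn S n R).hecke_slash_delta_eq_sum hp hδ hβ φ]
  have hterm : ∀ j : ZMod p, (CoeffActionOn.symPowOn S n R).slash ((p : ℤ) • CoeffActionOn.tMat (j.val : ℤ)) φ = ((p : ℤ) : R) ^ n • φ := by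
    intro j
    have hdet : (CoeffActionOn.tMat (j.val : ℤ)).det ≠ 0 := by
      rw [CoeffActionOn.tMat, Matrix.det_fin_two_of]; simp
    rw [symPowOn_slash_smul (by exact_mod_cast hp) hdet, ← CoeffActionOn.coe_T_zpow_eq_tMat,
      hφ.2 _ (CoeffActionOn.T_zpow_mem_gamma0 N _)]
  simp_rw [hterm]
  rw [Finset.sum_const, Finset.card_univ, ZMod.card, Int.cast_natCast, ← Nat.cast_smul_eq_nsmul R, smul_smul, pow_succ, mul_comm]

/-- **The `p`-stabilised `Symⁿ`-valued eigensymbol**: for `T_p φ = a_p φ` on `Γ₀(N)`, `p ∤ N`, and a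
unit root `α` of `X² − a_p X + p^{n+1}`, `φ_α = φ − α⁻¹ φ|δ ∈ Symb_{Γ₀(Np)}(Symⁿ)` and `U_p φ_α = α φ_α`.
[cite: GreenbergStevens1993, (4.8)–(4.9)] -/
theorem symPow_pStabilise [NeZero p] (hp : p ≠ 0) (hpN : ¬ p ∣ N) (hδ : deltaMat p ∈ S) (hβ : ∀ j : ZMod p, heckeRep p (some j) ∈ S)
    (hΓ : ∀ γ : SL(2, ℤ), γ ∈ Gamma0 N → (γ : Matrix (Fin 2) (Fin 2) ℤ) ∈ S)
    {φ : P1Q → P1Q → (Fin (n + 1) → R)} (hφ : φ ∈ (CoeffActionOn.symPowOn S n R).Symb (Gamma0 N)) {ap : R}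
    (hT : (CoeffActionOn.symPowOn S n R).hecke N p φ = ap • φ) (α : Rˣ) (hα : (α : R) ^ 2 - ap * α + (p : R) ^ (n + 1) = 0) :
    φ - ((α⁻¹ : Rˣ) : R) • (CoeffActionOn.symPowOn S n R).slash (deltaMat p) φ ∈ (CoeffActionOn.symPowOn S n R).Symb (Gamma0 (N * p)) ∧
      (CoeffActionOn.symPowOn S n R).hecke (N * p) p (φ - ((α⁻¹ : Rˣ) : R) • (CoeffActionOn.symPowOn S n R).slash (deltaMat p) φ) =
        (α : R) • (φ - ((α⁻¹ : Rˣ) : R) • (CoeffActionOn.symPowOn S n R).slash (deltaMat p) φ) :=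
  ⟨(CoeffActionOn.symPowOn S n R).pStabilise_mem_Symb hp hδ hΓ hφ _,
    (CoeffActionOn.symPowOn S n R).hecke_pStabilise hpN hT (hecke_slash_delta_symPow hp hδ hβ hφ) α hα⟩

end SymPow

end Literature.NumberTheory.EllipticCurves

end
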